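import Summits.QuantumFields.YangMills.Theorems.ColdStartUniversalityLatticeLangevinSynchronousCoupling
import HarnessLib

/-!
# Route `ColdStartUniversality` (fixed-cut-off SZZ dynamics; conjugation calculus, file 8):
# AT `β = 0` SYNCHRONOUS COUPLING IS AN EXACT ISOMETRY — the conjugated product is conserved path by path

Helper file (seat `ym-line-csu-p1`, g23).  An honest structural fact for the coupling lines of the cold-start routes:
for the FREE dynamics (`β = 0`, left-invariant Brownian motion on `SU(2)^E` with its Itô drift) and two starts `x, y`
driven by the SAME flat noise, the conjugated product is CONSTANT in time, almost surely for all `t`: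
`(ρU^y_e(t))ᴴ ρU^x_e(t) = (ρy_e)ᴴ ρx_e` (`conjProduct_const_of_free`), hence the Hilbert–Schmidt distance is exactly
conserved, `Σ_e ‖ρU^x_e(t) − ρU^y_e(t)‖_F² = Σ_e ‖ρx_e − ρy_e‖_F²` (`hsDist_const_of_free`).  So synchronous coupling
NEVER contracts by itself: in the conjugation identity the only source of distance change is the drift difference
`D_β(U^x) − D_β(U^y)` (the curvature of `SU(2)` — which drives the Bakry–Émery/Kendall–Cranston contraction — is
invisible to the synchronous coupling; cf. LINE 10 «harris_hybrid», which uses reflected noise).  Corollary of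
`reIm_conjProduct_pair_eq_add_integral` with `β ≡ 0` (`driftLie_zero`).  THEOREMS ONLY, no sorry.  HONEST FRAMING:
fixed-cut-off structural fact; no crux, rung or summit statement is proved; the Yang–Mills mass gap is NOT proved.
-/

set_option autoImplicit false

noncomputable section

namespace Summit.QuantumFields.YangMills.Theorems.ColdStartUniversality

open MeasureTheory ProbabilityTheory Finset Filter
open scoped NNReal Matrix ComplexConjugate Topology
open Literature.Probability.Process Literature.MathematicalPhysics.QuantumFieldTheory
open Literature.MathematicalPhysics.QuantumLattice (fundamentalRep fundamentalLatticeRep continuous_fundamentalRep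
  fundamentalRep_mem_unitaryGroup)

/-- ★ **At `β = 0` the conjugated product is conserved.**  For a regular solution family `U` of the FREE SZZ dynamics
(`β = 0`) and two starts `x, y` (same flat noise): almost surely, for all `t` and every link `e`,
`(ρU^y_e(t))ᴴ ρU^x_e(t) = (ρy_e)ᴴ ρx_e`. [folklore] -/
theorem conjProduct_const_of_free (L : ℕ) [NeZero L] {Ω : Type} [MeasurableSpace Ω] {P : Measure Ω}
    [IsProbabilityMeasure P] {W : ℝ≥0 → Ω → (Edge 3 L × NoiseIdx 2 → ℝ)} (hW : IsFlatBrownian W P)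
    (U : GaugeConfig 3 L (Matrix.specialUnitaryGroup (Fin 2) ℂ) → ℝ≥0 → Ω →
      GaugeConfig 3 L (Matrix.specialUnitaryGroup (Fin 2) ℂ))
    (hU : ∀ x, (∀ ω, U x 0 ω = x) ∧
      (latticeLangevinDynamics (fundamentalLatticeRep 2) 0).IsSolution (fundamentalRep (Fin 2)) hW.natFiltration P W (U x))
    (hUm : ∀ i : ℝ≥0, Measurable[@Prod.instMeasurableSpace (Set.Iic i)
        (GaugeConfig 3 L (Matrix.specialUnitaryGroup (Fin 2) ℂ) × Ω) inferInstance
        (@Prod.instMeasurableSpace (GaugeConfig 3 L (Matrix.specialUnitaryGroup (Fin 2) ℂ)) Ω inferInstance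
          (hW.natFiltration i))]
      (fun q : Set.Iic i × (GaugeConfig 3 L (Matrix.specialUnitaryGroup (Fin 2) ℂ) × Ω) => U q.2.1 q.1 q.2.2))
    (x y : GaugeConfig 3 L (Matrix.specialUnitaryGroup (Fin 2) ℂ)) :
    ∀ᵐ ω ∂P, ∀ (t : ℝ≥0) (e : Edge 3 L),
      ((fundamentalLatticeRep 2).ρ (U y t ω e))ᴴ * (fundamentalLatticeRep 2).ρ (U x t ω e) =
        ((fundamentalLatticeRep 2).ρ (y e))ᴴ * (fundamentalLatticeRep 2).ρ (x e) := by
  have hid : ∀ (e : Edge 3 L) (k l : Fin (fundamentalLatticeRep 2).N) (c : Bool), ∀ᵐ ω ∂P, ∀ t : ℝ≥0,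
      (fun z : ℂ => if c then z.im else z.re)
          ((((fundamentalLatticeRep 2).ρ (U y t ω e))ᴴ * (fundamentalLatticeRep 2).ρ (U x t ω e)) k l) =
        (fun z : ℂ => if c then z.im else z.re)
          ((((fundamentalLatticeRep 2).ρ (y e))ᴴ * (fundamentalLatticeRep 2).ρ (x e)) k l) := by
    intro e k l c
    have h := reIm_conjProduct_pair_eq_add_integral L (fun _ => (0 : ℝ)) hW (fun _ => U) (fun _ x' => hU x')
      (fun _ i => hUm i) (fun s => cond s x y) e k l c
    filter_upwards [h] with ω hω t
    have h1 := hω t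
    simp only [cond_true, cond_false, driftLie_zero, sub_self, Matrix.mul_zero, Matrix.zero_mul, Matrix.zero_apply,
      Complex.zero_re, Complex.zero_im, ite_self, integral_zero, add_zero] at h1
    exact h1
  have hall : ∀ᵐ ω ∂P, ∀ (e : Edge 3 L) (k l : Fin (fundamentalLatticeRep 2).N) (c : Bool) (t : ℝ≥0),
      (fun z : ℂ => if c then z.im else z.re)
          ((((fundamentalLatticeRep 2).ρ (U y t ω e))ᴴ * (fundamentalLatticeRep 2).ρ (U x t ω e)) k l) =
        (fun z : ℂ => if c then z.im else z.re)
          ((((fundamentalLatticeRep 2).ρ (y e))ᴴ * (fundamentalLatticeRep 2).ρ (x e)) k l) :=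
    ae_all_iff.2 fun e => ae_all_iff.2 fun k => ae_all_iff.2 fun l => ae_all_iff.2 fun c => hid e k l c
  filter_upwards [hall] with ω hω t e
  ext k l
  apply Complex.ext
  · exact hω e k l false t
  · exact hω e k l true t

/-- ★ **At `β = 0` synchronous coupling is an exact isometry**: the Hilbert–Schmidt distance between two solutions of
the free dynamics driven by the same noise is conserved, almost surely for all `t`:
`Σ_e ‖ρU^x_e(t) − ρU^y_e(t)‖_F² = Σ_e ‖ρx_e − ρy_e‖_F²`. [folklore] -/
theorem hsDist_const_of_free (L : ℕ) [NeZero L] {Ω : Type} [MeasurableSpace Ω] {P : Measure Ω}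
    [IsProbabilityMeasure P] {W : ℝ≥0 → Ω → (Edge 3 L × NoiseIdx 2 → ℝ)} (hW : IsFlatBrownian W P)
    (U : GaugeConfig 3 L (Matrix.specialUnitaryGroup (Fin 2) ℂ) → ℝ≥0 → Ω →
      GaugeConfig 3 L (Matrix.specialUnitaryGroup (Fin 2) ℂ))
    (hU : ∀ x, (∀ ω, U x 0 ω = x) ∧
      (latticeLangevinDynamics (fundamentalLatticeRep 2) 0).IsSolution (fundamentalRep (Fin 2)) hW.natFiltration P W (U x))
    (hUm : ∀ i : ℝ≥0, Measurable[@Prod.instMeasurableSpace (Set.Iic i)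
        (GaugeConfig 3 L (Matrix.specialUnitaryGroup (Fin 2) ℂ) × Ω) inferInstance
        (@Prod.instMeasurableSpace (GaugeConfig 3 L (Matrix.specialUnitaryGroup (Fin 2) ℂ)) Ω inferInstance
          (hW.natFiltration i))]
      (fun q : Set.Iic i × (GaugeConfig 3 L (Matrix.specialUnitaryGroup (Fin 2) ℂ) × Ω) => U q.2.1 q.1 q.2.2))
    (x y : GaugeConfig 3 L (Matrix.specialUnitaryGroup (Fin 2) ℂ)) :
    ∀ᵐ ω ∂P, ∀ t : ℝ≥0,
      ∑ e, hsForm (fundamentalLatticeRep 2).N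
          ((fundamentalLatticeRep 2).ρ (U x t ω e) - (fundamentalLatticeRep 2).ρ (U y t ω e))
          ((fundamentalLatticeRep 2).ρ (U x t ω e) - (fundamentalLatticeRep 2).ρ (U y t ω e)) =
      ∑ e, hsForm (fundamentalLatticeRep 2).N
          ((fundamentalLatticeRep 2).ρ (x e) - (fundamentalLatticeRep 2).ρ (y e))
          ((fundamentalLatticeRep 2).ρ (x e) - (fundamentalLatticeRep 2).ρ (y e)) := by
  have hρu : ∀ g : Matrix.specialUnitaryGroup (Fin 2) ℂ,
      (fundamentalLatticeRep 2).ρ g ∈ Matrix.unitaryGroup (Fin (fundamentalLatticeRep 2).N) ℂ :=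
    (fundamentalLatticeRep 2).mem_unitary
  -- `‖Q − Q'‖² = ‖Q'ᴴ Q − 1‖²` for unitary `Q, Q'`
  have hkey : ∀ g g' : Matrix.specialUnitaryGroup (Fin 2) ℂ,
      hsForm (fundamentalLatticeRep 2).N ((fundamentalLatticeRep 2).ρ g - (fundamentalLatticeRep 2).ρ g')
          ((fundamentalLatticeRep 2).ρ g - (fundamentalLatticeRep 2).ρ g') =
        hsForm (fundamentalLatticeRep 2).N
          (((fundamentalLatticeRep 2).ρ g')ᴴ * (fundamentalLatticeRep 2).ρ g - 1)
          (((fundamentalLatticeRep 2).ρ g')ᴴ * (fundamentalLatticeRep 2).ρ g - 1) := by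
    intro g g'
    have hu : ((fundamentalLatticeRep 2).ρ g')ᴴ * (fundamentalLatticeRep 2).ρ g' = 1 := by
      rw [← Matrix.star_eq_conjTranspose]; exact Matrix.mem_unitaryGroup_iff'.1 (hρu g')
    have hWW : (((fundamentalLatticeRep 2).ρ g')ᴴ)ᴴ * ((fundamentalLatticeRep 2).ρ g')ᴴ = 1 := by
      rw [Matrix.conjTranspose_conjTranspose, ← Matrix.star_eq_conjTranspose]
      exact Matrix.mem_unitaryGroup_iff.1 (hρu g')
    have h1 : ((fundamentalLatticeRep 2).ρ g')ᴴ * (fundamentalLatticeRep 2).ρ g - 1 =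
        ((fundamentalLatticeRep 2).ρ g')ᴴ * ((fundamentalLatticeRep 2).ρ g - (fundamentalLatticeRep 2).ρ g') := by
      rw [Matrix.mul_sub, hu]
    rw [h1, hsForm_mul_left_of_conjTranspose_mul_eq_one hWW]
  filter_upwards [conjProduct_const_of_free L hW U hU hUm x y] with ω hω t
  refine sum_congr rfl fun e _ => ?_
  rw [hkey, hkey, hω t e]

end Summit.QuantumFields.YangMills.Theorems.ColdStartUniversality

end
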